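import Mathlib
import Summits.ValiantsHypothesis.ValiantsHypothesis.Theorems.KPlusLogSqLawWeakLiftingTowerGraftResidualDeterminant
import Summits.ValiantsHypothesis.ValiantsHypothesis.Theorems.LacunarySymmetroidMatrixDescartesStubBlockSector
import Summits.ValiantsHypothesis.ValiantsHypothesis.Theorems.LacunarySymmetroidMatrixDescartesRolleSchurCompression

/-!
# Tower graft line — THE RANK-ONE GRAFT LAW IN CLASS FORM (unconditional)

Mechanism file for the line `Cruxes/WeakLifting/Lines/tower_graft.lean` (crux `WeakLifting` = stmt-ValiantsHypothesis-19561,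
restricted sub-case `TowerWeakLifting`; S4/S5 side, NO stub is claimed).  Companion of `…TowerGraftResidualDeterminant.lean`
(the residual of the Rolle–Schur step is a class determinant at size `2m+1` on the same support).

`card_posRoots_rankOneGraft_le`: for `K ≥ 1`, ANY support `d`, any far exponent `D` and any real `a` (either sign),
`PosRootLawOn (m+1) K B d → PosRootLawOn (m+1+m) K B' d →`
`#{t > 0 : det (∑ₗ X^{dₗ} Sₗ + a·X^D·E₀₀)(t) = 0} ≤ 2B + B' + 1` for all symmetric letters `Sₗ`;
`card_posRoots_rankOneGraft_vec_le`: the same bound for an ARBITRARY rank-one far letter `a·X^D·w wᵀ` (constant frame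
`T w = (w·w) e₀` of the tree's `RolleSchur.exists_frame`, congruence `T Sₗ Tᵀ` keeps support and symmetry, `det` changes by `(det T)²`).
`card_posRoots_rankOneGraft_le_of_sizeDoubling`: hence a SIZE-DOUBLING hypothesis on the class (`B ↦ 2^C₀·B + A` from size
`m+1` to size `m+1+m` on the same support — a statement with NO graft) gives the rank-one graft law with constant `2^C₀ + 2`
(the reduction offered to the line planner for the corner rung S4b; whether size-doubling is easier than Conjecture B is open).
Proof: the tree's Rolle–Schur step (`RolleSchur.posRoots_det_le`, line `rolle_schur_residual` of 18050) applied to the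
GRAFTED matrix `F` with `v = e₀` and shift `e = D` sees only base data — `adj(F) e₀ = adj(G) e₀` (the graft touches only the
entry `(0,0)`), `(adj F)₀₀ = det G₀₀` (a size-`m` symmetric pencil on `d`, identity-padded, `posRootLawOn_of_succ`: `≤ B`), and
`X F′ − D F = X G′ − D G` (the far letter is killed by its own exponent) — so
`Z₊(det F) ≤ Z₊(residual) + Z₊(det G₀₀) + 1 + #{common} ≤ B' + B + 1 + B`; degenerate cases (`a = 0`, `det F = 0`,
`det G₀₀ = 0`, `det G = 0`) are paid by `B` directly (`det (G + g E₀₀) = det G + g det G₀₀`).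

PRIOR ART in the tree: the desk's GRAFT CALCULUS (`…GraftLaw.lean`, `…GraftToolkit.lean`, `…TailGraft*.lean`: the LOWER-bound
direction, one more letter buys `m` more alternations) and the Rolle–Schur step (`…RolleSchurStep.lean`, p586469), which this file
applies to the grafted matrix.  HONEST FRAMING: the graft excess of a RANK-ONE far letter is the class census at size `2m+1` — no tower / steepness hypothesis,
no additive term, but the class size doubles per graft, so iterating along a tower yields only `m^{O(K)}` (Descartes level):
this does NOT prove S4 (`TowerGraftLawId`), S5 (`TowerGraftLaw`), TowerB, `WeakLifting`, Conjecture B, `MatrixDescartes`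
(18050) or anything about `VP ≠ VNP`.  Def-free.  Seat: prover val-sym-lift-p3 g16, `--supports stmt-ValiantsHypothesis-19561`.
-/

-- `Summit.ValiantsHypothesis.ValiantsHypothesis.…` repeats a component by the D-0017 layout
-- (single-conjunct summit), which the `dupNamespace` linter flags; the name is mandated.
set_option linter.dupNamespace false

namespace Summit.ValiantsHypothesis.ValiantsHypothesis.Theorems.KPlusLogSqLaw.TowerGraft

open Finset Polynomial Matrix
open scoped BigOperators Polynomial
open Summit.ValiantsHypothesis.ValiantsHypothesis.Theorems.LacunarySymmetroidMatrixDescartes (PosRootLawOn)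

/-! ## §5 The rank-one graft law in CLASS form (unconditional)

Grafting `a·X^D • E₀₀` (`a ≠ 0`, any sign) on `G = ∑ₗ X^{dₗ} Sₗ` of size `m+1`: the tree's Rolle–Schur step
(`RolleSchur.posRoots_det_le`, applied to the grafted matrix with `v = e₀`, shift `e = D`) sees only BASE data — the
adjugate column `adj(F) e₀ = adj(G) e₀`, the compression `(adj F)₀₀ = det G₀₀`, and the shifted matrix
`X F′ − D F = X G′ − D G` (the far letter is killed by its own exponent) — so
`Z₊(det F) ≤ Z₊(residual) + 2·Z₊(det G₀₀) + 1 ≤ B' + 2B + 1`. -/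

section Graft

variable {m : ℕ}

/-- identity padding by one: `det (∑ₗ X^{dₗ} (Sₗ ⊕ 1)) = det (∑ₗ X^{dₗ} Sₗ) · ∑ₗ X^{dₗ}`. [folklore]
-- adapted from the tree's `Census.det_pencil_padOne` (…CensusFormatMonotone.lean), restated here to keep this file
-- route-independent (that module imports a Theses file). -/
theorem det_pencil_padOne_one {K : ℕ} (d : Fin K → ℕ) (S : Fin K → Matrix (Fin m) (Fin m) ℝ) :
    Matrix.det (∑ l, ((Polynomial.X : Polynomial ℝ) ^ d l) •
        (Matrix.reindex finSumFinEquiv finSumFinEquiv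
          (Matrix.fromBlocks (S l) 0 0 (1 : Matrix (Fin 1) (Fin 1) ℝ))).map Polynomial.C)
      = Matrix.det (∑ l, ((Polynomial.X : Polynomial ℝ) ^ d l) • (S l).map Polynomial.C) *
          (∑ l, (Polynomial.X : Polynomial ℝ) ^ d l) := by
  have h1 : (∑ l, ((Polynomial.X : Polynomial ℝ) ^ d l) •
        (Matrix.reindex finSumFinEquiv finSumFinEquiv
          (Matrix.fromBlocks (S l) 0 0 (1 : Matrix (Fin 1) (Fin 1) ℝ))).map Polynomial.C)
      = Matrix.reindex finSumFinEquiv finSumFinEquiv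
          (∑ l, ((Polynomial.X : Polynomial ℝ) ^ d l) •
            (Matrix.fromBlocks (S l) 0 0 (1 : Matrix (Fin 1) (Fin 1) ℝ)).map Polynomial.C) := by
    refine Matrix.ext fun i j => ?_
    simp only [Matrix.reindex_apply, Matrix.submatrix_apply, Matrix.sum_apply, Matrix.smul_apply,
      Matrix.map_apply]
  have h2 : (∑ l, ((Polynomial.X : Polynomial ℝ) ^ d l) • ((1 : Matrix (Fin 1) (Fin 1) ℝ).map Polynomial.C))
      = (∑ l, (Polynomial.X : Polynomial ℝ) ^ d l) • (1 : Matrix (Fin 1) (Fin 1) (Polynomial ℝ)) := by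
    rw [Matrix.map_one Polynomial.C (map_zero _) (map_one _), Finset.sum_smul]
  rw [h1, Matrix.det_reindex_self,
    Summit.ValiantsHypothesis.ValiantsHypothesis.Theorems.LacunarySymmetroidMatrixDescartes.StubBlockSector.sum_smul_fromBlocks_map,
    Matrix.det_fromBlocks_zero₂₁, h2, Matrix.det_smul, Matrix.det_one, mul_one, Fintype.card_fin, pow_one]

/-- **size step of the budget on a fixed support** (`K ≥ 1`): if every symmetric pencil of size `m+1` on `d` has at most `B`
positive roots of its determinant, so does every symmetric pencil of size `m` on `d` — pad with a `1 × 1` identity block: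
the determinant acquires the factor `∑ₗ X^{dₗ} ≠ 0`, which only adds roots. [folklore] -/
theorem posRootLawOn_of_succ {K B : ℕ} (hK : 0 < K) {d : Fin K → ℕ} (h : PosRootLawOn (m + 1) K B d) :
    PosRootLawOn m K B d := by
  intro S hS
  set S' : Fin K → Matrix (Fin (m + 1)) (Fin (m + 1)) ℝ := fun l =>
    Matrix.reindex finSumFinEquiv finSumFinEquiv (Matrix.fromBlocks (S l) 0 0 (1 : Matrix (Fin 1) (Fin 1) ℝ)) with hS'
  have hS'symm : ∀ l, (S' l).IsSymm := fun l =>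
    (Matrix.IsSymm.fromBlocks (hS l) (by simp) Matrix.isSymm_one).submatrix _
  have hne : (∑ l, (Polynomial.X : Polynomial ℝ) ^ d l) ≠ 0 := by
    intro h0
    have h1 : Polynomial.eval (1 : ℝ) (∑ l, (Polynomial.X : Polynomial ℝ) ^ d l) = K := by
      rw [Polynomial.eval_finsetSum]; simp
    rw [h0, Polynomial.eval_zero] at h1
    exact (Nat.cast_ne_zero.2 hK.ne') h1.symm
  have hdet := det_pencil_padOne_one d S
  have hle : ((Matrix.det (∑ l, ((Polynomial.X : Polynomial ℝ) ^ d l) • (S l).map Polynomial.C)).roots.toFinset.filter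
      (fun t => 0 < t)).card ≤
      ((Matrix.det (∑ l, ((Polynomial.X : Polynomial ℝ) ^ d l) • (S' l).map Polynomial.C)).roots.toFinset.filter
        (fun t => 0 < t)).card := by
    rw [hS', hdet]
    by_cases hp : Matrix.det (∑ l, ((Polynomial.X : Polynomial ℝ) ^ d l) • (S l).map Polynomial.C) = 0
    · rw [hp]; simp
    refine Finset.card_le_card (Finset.filter_subset_filter _ fun t ht => ?_)
    rw [Multiset.mem_toFinset] at ht ⊢
    rw [Polynomial.roots_mul (mul_ne_zero hp hne)]
    exact Multiset.mem_add.2 (Or.inl ht)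
  exact hle.trans (h S' hS'symm)

/-- the graft touches only the entry `(0,0)`: replacing row `0` erases it. [folklore] -/
theorem updateRow_graft (G : Matrix (Fin (m + 1)) (Fin (m + 1)) ℝ[X]) (g : ℝ[X]) (r : Fin (m + 1) → ℝ[X]) :
    (G + g • Matrix.single (0 : Fin (m + 1)) (0 : Fin (m + 1)) (1 : ℝ[X])).updateRow 0 r = G.updateRow 0 r := by
  ext i j
  rcases eq_or_ne i 0 with rfl | hi
  · simp [Matrix.updateRow_self]
  · simp [Matrix.updateRow_ne hi, Matrix.single, hi.symm]

/-- hence the adjugate column at `e₀` does not see the graft. [folklore] -/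
theorem adjugate_graft_col_zero (G : Matrix (Fin (m + 1)) (Fin (m + 1)) ℝ[X]) (g : ℝ[X]) (i : Fin (m + 1)) :
    (G + g • Matrix.single (0 : Fin (m + 1)) (0 : Fin (m + 1)) (1 : ℝ[X])).adjugate i 0 = G.adjugate i 0 := by
  rw [Matrix.adjugate_apply, Matrix.adjugate_apply, updateRow_graft]

/-- `adj(G + g E₀₀) e₀ = adj(G) e₀`. [folklore] -/
theorem adjugate_graft_mulVec_single (G : Matrix (Fin (m + 1)) (Fin (m + 1)) ℝ[X]) (g : ℝ[X]) :
    (G + g • Matrix.single (0 : Fin (m + 1)) (0 : Fin (m + 1)) (1 : ℝ[X])).adjugate *ᵥ Pi.single 0 1 =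
      G.adjugate *ᵥ Pi.single 0 1 := by
  rw [Matrix.mulVec_single_one, Matrix.mulVec_single_one]
  ext i
  simp only [Matrix.col_apply, adjugate_graft_col_zero]

/-- the compression `e₀ᵀ adj(G) e₀` is the determinant of the `(0,0)`-minor. [folklore] -/
theorem single_dotProduct_adjugate_mulVec_single (G : Matrix (Fin (m + 1)) (Fin (m + 1)) ℝ[X]) :
    Pi.single (0 : Fin (m + 1)) (1 : ℝ[X]) ⬝ᵥ (G.adjugate *ᵥ Pi.single 0 1) = (G.submatrix Fin.succ Fin.succ).det := by
  rw [Matrix.mulVec_single_one, single_dotProduct, one_mul, Matrix.col_apply, Matrix.adjugate_fin_succ_eq_det_submatrix]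
  simp

/-- the far letter is killed by its own exponent: `X·(X^D a • E₀₀)′ − D·(X^D a • E₀₀) = 0`. [folklore] -/
theorem shift_kills_graft (D : ℕ) (a : ℝ) :
    (X : ℝ[X]) • ((((X : ℝ[X]) ^ D * C a) • Matrix.single (0 : Fin (m + 1)) (0 : Fin (m + 1)) (1 : ℝ[X])).map
        (⇑derivative)) -
      C (D : ℝ) • (((X : ℝ[X]) ^ D * C a) • Matrix.single (0 : Fin (m + 1)) (0 : Fin (m + 1)) (1 : ℝ[X])) = 0 := by
  refine Matrix.ext fun i j => ?_
  simp only [Matrix.smul_apply, Matrix.map_apply, Matrix.sub_apply, Matrix.zero_apply, smul_eq_mul, Matrix.single,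
    Matrix.of_apply]
  split_ifs
  · simp only [mul_one]
    rw [derivative_mul, derivative_C, mul_zero, add_zero, ← mul_assoc,
      Summit.ValiantsHypothesis.ValiantsHypothesis.Theorems.LacunarySymmetroidMatrixDescartes.RolleSchur.X_mul_derivative_X_pow]
    ring
  · simp

/-- grafting the coordinate rank-one letter: `det (G + g • E₀₀) = det G + g · det G₀₀`. [folklore] -/
theorem det_add_smul_single_zero (G : Matrix (Fin (m + 1)) (Fin (m + 1)) ℝ[X]) (g : ℝ[X]) :
    (G + g • Matrix.single (0 : Fin (m + 1)) (0 : Fin (m + 1)) (1 : ℝ[X])).det =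
      G.det + g * (G.submatrix Fin.succ Fin.succ).det := by
  have h1 : G + g • Matrix.single (0 : Fin (m + 1)) (0 : Fin (m + 1)) (1 : ℝ[X]) =
      G.updateRow 0 (G 0 + g • Pi.single (0 : Fin (m + 1)) (1 : ℝ[X])) := by
    ext i j
    rcases eq_or_ne i 0 with rfl | hi
    · simp [Matrix.updateRow_self, Matrix.single, Pi.single_apply, eq_comm]
    · simp [Matrix.updateRow_ne hi, Matrix.single, hi.symm]
  rw [h1, Matrix.det_updateRow_add, Matrix.updateRow_eq_self, Matrix.det_updateRow_smul, ← Matrix.adjugate_apply,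
    Matrix.adjugate_fin_succ_eq_det_submatrix]
  simp

/-- **RANK-ONE GRAFT LAW, CLASS FORM (unconditional).**  On ANY support `d` with `K ≥ 1` letters, let `B` bound the
positive roots of every symmetric pencil of size `m+1` on `d` and `B'` those of every symmetric pencil of size `m+1+m` on
`d`.  Then for every symmetric `G = ∑ₗ X^{dₗ} Sₗ` of size `m+1`, every far exponent `D` and every real `a`,
`#{t > 0 : det (G + a X^D E₀₀)(t) = 0} ≤ 2B + B' + 1`: the graft excess over the base budget is paid by the class census
at size `2m+1` on the SAME support (the residual of the Rolle–Schur step is `± det Θ`, §4) — no tower / steepness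
hypothesis, no additive term.  (A general rank-one far letter `a·wwᵀ`: `card_posRoots_rankOneGraft_vec_le` below, by a constant frame.) [this work] -/
theorem card_posRoots_rankOneGraft_le {K B B' : ℕ} (hK : 0 < K) (d : Fin K → ℕ) (D : ℕ) (a : ℝ)
    (hB : PosRootLawOn (m + 1) K B d) (hB' : PosRootLawOn (m + 1 + m) K B' d)
    (S : Fin K → Matrix (Fin (m + 1)) (Fin (m + 1)) ℝ) (hS : ∀ l, (S l).IsSymm) :
    (((∑ l, ((X : ℝ[X]) ^ d l) • (S l).map C) +
          ((X : ℝ[X]) ^ D * C a) • Matrix.single (0 : Fin (m + 1)) (0 : Fin (m + 1)) (1 : ℝ[X])).det.roots.toFinset.filter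
        (fun t => 0 < t)).card ≤ 2 * B + B' + 1 := by
  set G := ∑ l, ((X : ℝ[X]) ^ d l) • (S l).map C with hG
  set F := G + ((X : ℝ[X]) ^ D * C a) • Matrix.single (0 : Fin (m + 1)) (0 : Fin (m + 1)) (1 : ℝ[X]) with hF
  -- the (0,0)-minor pencil `q` and its budget (size `m`, identity-padded to `m+1`)
  set q : ℝ[X] := (∑ l, ((X : ℝ[X]) ^ d l) • ((S l).submatrix Fin.succ Fin.succ).map C).det with hq
  have hGsub : G.submatrix Fin.succ Fin.succ =
      ∑ l, ((X : ℝ[X]) ^ d l) • ((S l).submatrix Fin.succ Fin.succ).map C := by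
    refine Matrix.ext fun i j => ?_
    simp [hG, Matrix.submatrix_apply, Matrix.sum_apply, Matrix.smul_apply, Matrix.map_apply]
  have hqB : (q.roots.toFinset.filter (fun t => 0 < t)).card ≤ B :=
    posRootLawOn_of_succ hK hB (fun l => (S l).submatrix Fin.succ Fin.succ) (fun l => (hS l).submatrix _)
  have hpB : (G.det.roots.toFinset.filter (fun t => 0 < t)).card ≤ B := hB S hS
  have hdetF_eq : F.det = G.det + (X : ℝ[X]) ^ D * C a * q := by
    rw [hF, det_add_smul_single_zero, hGsub]
  -- degenerate cases: `a = 0` (no graft), `det F = 0` (no counted roots), `q = 0` (det F = det G), `det G = 0`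
  by_cases ha : a = 0
  · have : F.det = G.det := by rw [hdetF_eq, ha, C_0, mul_zero, zero_mul, add_zero]
    rw [this]; omega
  by_cases hdetF : F.det = 0
  · rw [hdetF]; simp
  by_cases hq0 : q = 0
  · rw [hdetF_eq, hq0, mul_zero, add_zero]; omega
  have hcommon : ∀ t : ℝ, 0 < t → F.det.eval t = 0 → G.det.eval t = 0 → q.eval t = 0 := by
    intro t ht hFt hGt
    rw [hdetF_eq, eval_add, hGt, zero_add, eval_mul, eval_mul, eval_pow, eval_X, eval_C] at hFt
    rcases mul_eq_zero.1 hFt with h1 | h1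
    · rcases mul_eq_zero.1 h1 with h2 | h2
      · exact absurd h2 (pow_ne_zero _ ht.ne')
      · exact absurd h2 ha
    · exact h1
  by_cases hp0 : G.det = 0
  · -- `det F = X^D · a · q`: every positive root of `det F` is a root of `q`
    have hsub : (F.det.roots.toFinset.filter (fun t => 0 < t)) ⊆ (q.roots.toFinset.filter (fun t => 0 < t)) := by
      intro t ht
      simp only [Finset.mem_filter, Multiset.mem_toFinset, mem_roots hdetF, mem_roots hq0, IsRoot.def] at ht ⊢
      exact ⟨hcommon t ht.2 ht.1 (by rw [hp0, eval_zero]), ht.2⟩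
    exact (Finset.card_le_card hsub).trans (by omega)
  -- generic case: the Rolle–Schur step on the GRAFTED matrix with `v = e₀`, shift `e = D`
  have hGsymm : G.IsSymm :=
    Summit.ValiantsHypothesis.ValiantsHypothesis.Theorems.LacunarySymmetroidMatrixDescartes.RolleSchur.pencil_isSymm d S hS
  have hEsymm : (((X : ℝ[X]) ^ D * C a) • Matrix.single (0 : Fin (m + 1)) (0 : Fin (m + 1)) (1 : ℝ[X])).IsSymm := by
    unfold Matrix.IsSymm
    rw [Matrix.transpose_smul, Matrix.transpose_single]
  have hFsymm : F.IsSymm := hGsymm.add hEsymm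
  have hv : ∀ i : Fin (m + 1), derivative ((Pi.single (0 : Fin (m + 1)) (1 : ℝ[X]) : Fin (m + 1) → ℝ[X]) i) = 0 := by
    intro i
    rcases eq_or_ne i 0 with rfl | hi
    · simp
    · simp [hi]
  have hstep :=
    Summit.ValiantsHypothesis.ValiantsHypothesis.Theorems.LacunarySymmetroidMatrixDescartes.RolleSchur.posRoots_det_le
      F hFsymm (Pi.single 0 1) hv (D : ℝ) hdetF
  -- the step sees only base data
  have hadj : F.adjugate *ᵥ Pi.single 0 1 = G.adjugate *ᵥ Pi.single 0 1 := adjugate_graft_mulVec_single G _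
  have hcomp : Pi.single (0 : Fin (m + 1)) (1 : ℝ[X]) ⬝ᵥ (G.adjugate *ᵥ Pi.single 0 1) = q := by
    rw [single_dotProduct_adjugate_mulVec_single, hGsub]
  have hshift : (X : ℝ[X]) • F.map (⇑derivative) - C (D : ℝ) • F =
      ∑ l, (C ((d l : ℝ) - (D : ℝ)) * (X : ℝ[X]) ^ d l) • (S l).map C := by
    rw [Summit.ValiantsHypothesis.ValiantsHypothesis.Theorems.LacunarySymmetroidMatrixDescartes.RolleSchur.shifted_eq d S D,
      ← hG, hF]
    have hmap : (G + ((X : ℝ[X]) ^ D * C a) • Matrix.single (0 : Fin (m + 1)) (0 : Fin (m + 1)) (1 : ℝ[X])).map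
        (⇑derivative) = G.map (⇑derivative) +
          ((((X : ℝ[X]) ^ D * C a) • Matrix.single (0 : Fin (m + 1)) (0 : Fin (m + 1)) (1 : ℝ[X])).map
            (⇑derivative)) :=
      Matrix.ext fun i j => by simp only [Matrix.map_apply, Matrix.add_apply, derivative_add]
    have h0 := shift_kills_graft (m := m) D a
    rw [hmap, smul_add, smul_add]
    rw [sub_eq_zero] at h0
    rw [show ∀ (A B Cc Dd : Matrix (Fin (m + 1)) (Fin (m + 1)) ℝ[X]), A + B - (Cc + Dd) = (A - Cc) + (B - Dd) from
      fun A B Cc Dd => by abel, h0]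
    simp
  rw [hadj, hcomp, hshift] at hstep
  have hres : (((G.adjugate *ᵥ Pi.single 0 1) ⬝ᵥ
      ((∑ l, (C ((d l : ℝ) - (D : ℝ)) * (X : ℝ[X]) ^ d l) • (S l).map C) *ᵥ
        (G.adjugate *ᵥ Pi.single 0 1))).roots.toFinset.filter (fun t => 0 < t)).card ≤ B' :=
    posRoots_residual_le d hB' (fun l => (d l : ℝ) - (D : ℝ)) S hS hp0
  -- the common-root term is bounded by the roots of `q`
  have hcom : (F.det.roots.toFinset.filter (fun x => 0 < x ∧ q.IsRoot x)).card ≤ B := by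
    refine le_trans (Finset.card_le_card ?_) hqB
    intro t ht
    simp only [Finset.mem_filter, Multiset.mem_toFinset, mem_roots hdetF, mem_roots hq0] at ht ⊢
    exact ⟨ht.2.2, ht.2.1⟩
  omega

end Graft

/-! ## §6 A general rank-one far letter `a · w wᵀ` (constant frame `w ↦ (w·w) e₀`, tree `RolleSchur.exists_frame`) -/

section GeneralVector

variable {m : ℕ}

/-- congruence of the grafted pencil by a constant frame `T` with `T w = μ e₀`:
`T̂ (G + g • w wᵀ) T̂ᵀ = ∑ₗ X^{dₗ} (T Sₗ Tᵀ) + (g μ²) • E₀₀`. [folklore] -/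
theorem frame_conj_rankOneGraft {K : ℕ} (d : Fin K → ℕ) (S : Fin K → Matrix (Fin (m + 1)) (Fin (m + 1)) ℝ)
    (T : Matrix (Fin (m + 1)) (Fin (m + 1)) ℝ) (w : Fin (m + 1) → ℝ) (μ : ℝ)
    (hTw : T *ᵥ w = μ • (Pi.single 0 1 : Fin (m + 1) → ℝ)) (g : ℝ[X]) :
    T.map C * ((∑ l, ((X : ℝ[X]) ^ d l) • (S l).map C) + g • (Matrix.vecMulVec w w).map C) * (T.map C)ᵀ =
      (∑ l, ((X : ℝ[X]) ^ d l) • (T * S l * Tᵀ).map C) +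
        (g * C (μ ^ 2)) • Matrix.single (0 : Fin (m + 1)) (0 : Fin (m + 1)) (1 : ℝ[X]) := by
  rw [Matrix.mul_add, Matrix.add_mul,
    Summit.ValiantsHypothesis.ValiantsHypothesis.Theorems.LacunarySymmetroidMatrixDescartes.RolleSchur.frame_mul_pencil_mul_transpose]
  congr 1
  have hmap : (Matrix.vecMulVec w w).map C = Matrix.vecMulVec (fun i => C (w i)) (fun i => C (w i)) := by
    refine Matrix.ext fun i j => ?_
    simp [Matrix.vecMulVec_apply]
  have hTw' : T.map C *ᵥ (fun i => C (w i)) = fun i => C μ * ((Pi.single (0 : Fin (m + 1)) (1 : ℝ[X]) : Fin (m + 1) → ℝ[X]) i) := by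
    have h2 : (fun i => C ((T *ᵥ w) i)) = T.map C *ᵥ (fun i => C (w i)) := by
      funext i
      simp [Matrix.mulVec, dotProduct, map_sum]
    rw [← h2]
    refine funext fun i => ?_
    have hi : C ((T *ᵥ w) i) = C ((μ • (Pi.single 0 1 : Fin (m + 1) → ℝ)) i) := by rw [hTw]
    rw [hi, Pi.smul_apply, smul_eq_mul, C_mul]
    rcases eq_or_ne i 0 with rfl | hi0
    · simp
    · simp [hi0]
  rw [Matrix.mul_smul, Matrix.smul_mul, hmap, Matrix.mul_vecMulVec, Matrix.vecMulVec_mul, Matrix.vecMul_transpose, hTw']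
  refine Matrix.ext fun i j => ?_
  simp only [Matrix.smul_apply, Matrix.vecMulVec_apply, Matrix.single, Matrix.of_apply, smul_eq_mul]
  rcases eq_or_ne i 0 with rfl | hi <;> rcases eq_or_ne j 0 with rfl | hj
  · simp only [Pi.single_eq_same, mul_one, and_self, if_true, map_pow]
    ring
  · simp [hj.symm]
  · simp [hi.symm]
  · simp [hi.symm]

/-- **RANK-ONE GRAFT LAW, CLASS FORM, for an arbitrary rank-one far letter `a · w wᵀ`.**  Same bound `2B + B' + 1` as for the
coordinate letter: a constant frame `T` with `T w = (w·w) e₀` (tree `RolleSchur.exists_frame`) conjugates the grafted pencil to a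
coordinate graft on the letters `T Sₗ Tᵀ` (same support, symmetric), and `det` only changes by the constant `(det T)² ≠ 0`. [this work] -/
theorem card_posRoots_rankOneGraft_vec_le {K B B' : ℕ} (hK : 0 < K) (d : Fin K → ℕ) (D : ℕ) (a : ℝ)
    (w : Fin (m + 1) → ℝ) (hB : PosRootLawOn (m + 1) K B d) (hB' : PosRootLawOn (m + 1 + m) K B' d)
    (S : Fin K → Matrix (Fin (m + 1)) (Fin (m + 1)) ℝ) (hS : ∀ l, (S l).IsSymm) :
    (((∑ l, ((X : ℝ[X]) ^ d l) • (S l).map C) +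
          ((X : ℝ[X]) ^ D * C a) • (Matrix.vecMulVec w w).map C).det.roots.toFinset.filter
        (fun t => 0 < t)).card ≤ 2 * B + B' + 1 := by
  by_cases hw : w = 0
  · subst hw
    have h0 : (Matrix.vecMulVec (0 : Fin (m + 1) → ℝ) (0 : Fin (m + 1) → ℝ)).map (C : ℝ →+* ℝ[X]) = 0 := by
      refine Matrix.ext fun i j => ?_
      simp
    rw [h0, smul_zero, add_zero]
    exact (hB S hS).trans (by omega)
  obtain ⟨T, hT, hTw⟩ :=
    Summit.ValiantsHypothesis.ValiantsHypothesis.Theorems.LacunarySymmetroidMatrixDescartes.RolleSchur.exists_frame w hw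
  set F := (∑ l, ((X : ℝ[X]) ^ d l) • (S l).map C) + ((X : ℝ[X]) ^ D * C a) • (Matrix.vecMulVec w w).map C with hF
  have hconj := frame_conj_rankOneGraft d S T w (w ⬝ᵥ w) hTw ((X : ℝ[X]) ^ D * C a)
  rw [← hF] at hconj
  -- determinants: `C (det T)^2 · det F = det (coordinate graft on the conjugated letters)`
  have hdet : (T.map C * F * (T.map C)ᵀ).det = C (T.det * T.det) * F.det := by
    rw [Matrix.det_mul, Matrix.det_mul, Matrix.det_transpose, ← RingHom.mapMatrix_apply, ← RingHom.map_det]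
    rw [C_mul]; ring
  have hTT : T.det * T.det ≠ 0 := mul_ne_zero hT hT
  have hroots : F.det.roots = ((∑ l, ((X : ℝ[X]) ^ d l) • (T * S l * Tᵀ).map C) +
      (((X : ℝ[X]) ^ D * C (a * (w ⬝ᵥ w) ^ 2)) • Matrix.single (0 : Fin (m + 1)) (0 : Fin (m + 1)) (1 : ℝ[X]))).det.roots := by
    rw [← Polynomial.roots_C_mul _ hTT, ← hdet, hconj, mul_assoc, ← C_mul]
  rw [hroots]
  have hS' : ∀ l, (T * S l * Tᵀ).IsSymm := fun l => by
    unfold Matrix.IsSymm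
    rw [Matrix.transpose_mul, Matrix.transpose_mul, Matrix.transpose_transpose, (hS l).eq, ← Matrix.mul_assoc]
  exact card_posRoots_rankOneGraft_le hK d D (a * (w ⬝ᵥ w) ^ 2) hB hB' (fun l => T * S l * Tᵀ) hS'

/-- **Corner / rank-one graft law from a SIZE-DOUBLING hypothesis (class statement, no graft).**  If on the support `d` the
class budget at size `m+1+m` is controlled by the budget at size `m+1` — `B ↦ 2^C₀·B + A` for every valid `B` — then every
rank-one graft `a·X^D·w wᵀ` on a symmetric pencil of size `m+1` on `d` has at most `(2^C₀ + 2)·B + A + 1` positive roots.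
(The reduction behind remark (R1) to the line planner: the line's corner law S4b follows from a size-doubling rung.) [this work] -/
theorem card_posRoots_rankOneGraft_le_of_sizeDoubling {K B : ℕ} (hK : 0 < K) (C₀ A : ℕ) (d : Fin K → ℕ)
    (hSD : ∀ B₀ : ℕ, PosRootLawOn (m + 1) K B₀ d → PosRootLawOn (m + 1 + m) K (2 ^ C₀ * B₀ + A) d)
    (D : ℕ) (a : ℝ) (w : Fin (m + 1) → ℝ) (hB : PosRootLawOn (m + 1) K B d)
    (S : Fin K → Matrix (Fin (m + 1)) (Fin (m + 1)) ℝ) (hS : ∀ l, (S l).IsSymm) :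
    (((∑ l, ((X : ℝ[X]) ^ d l) • (S l).map C) +
          ((X : ℝ[X]) ^ D * C a) • (Matrix.vecMulVec w w).map C).det.roots.toFinset.filter
        (fun t => 0 < t)).card ≤ (2 ^ C₀ + 2) * B + A + 1 := by
  have h := card_posRoots_rankOneGraft_vec_le hK d D a w hB (hSD B hB) S hS
  have : 2 * B + (2 ^ C₀ * B + A) + 1 = (2 ^ C₀ + 2) * B + A + 1 := by ring
  omega

end GeneralVector


end Summit.ValiantsHypothesis.ValiantsHypothesis.Theorems.KPlusLogSqLaw.TowerGraft
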